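/-
Origin: expansion seat `planner-pub-hodgecm-pv09-0`, handover 2026-08-18T03:44:22Z (`HOME/pub-hodgecm-pv09/lean/Pv09/RallisField.lean`, md5 a2560cad, 49 lines);
landed by the gen-5 packager in gate run 19 as `HodgeCM/PerL34/RallisField.lean` (import ^import Pv[0-9]+\.→import HodgeCM.PerL34. ×1).
-/
/-
pub-hodgecm speedrun cell, prover pv09 — WIP module `Pv09.RallisField` (landing target
`HodgeCM/PerL34/RallisField.lean`).  Imports `Pv09.RallisIP` (→ `HodgeCM.PerL34.RallisIP`).

PLUG for the N31 cluster assembly (pv13's `LocalFactorDatum.rallis : re ⟪θ,θ⟫ = c · vol · ∏' v, I v`):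
the field is N31e (this seat: ⟨θ_φ(χ′),θ_φ(χ′)⟩ = c·vol([U(W_i)])·∫_{U(W_i)(𝔸)}⟨ω(y)φ,φ⟩χ′(y)dy, tex l. 600)
followed by N31f's first sentence (pv07: for φ = ⊗φ_v the adelic integral is the Euler product ∏_v I_v(φ_v),
tex l. 608–609) and the definition of the Petersson norm of θ_φ(χ′) as the double integral of the theta kernel
inner integral (tex l. 594–596, nodes N10/N31d).  `rallis_field_of_N31e` does exactly this bookkeeping.
-/
import Summits.HodgeConjecture.HodgeCM.PerL34.RallisIP

/-! PORT of `HodgeCM/PerL34/RallisField.lean` (HodgeCMPerL run 82) — verbatim mechanical port; provenance in the PORT header line. -/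

set_option autoImplicit false

open MeasureTheory Complex ComplexConjugate
open scoped InnerProductSpace

namespace HodgeCM.PerL34.RallisIP

variable {A S E : Type*} [CommGroup A] [NormedAddCommGroup S] [InnerProductSpace ℂ S] [MeasurableSpace A]
  [NormedAddCommGroup E] [InnerProductSpace ℂ E]

/-- **N31e ⇒ the `rallis` field of the cluster datum.**  Inputs, all labelled:
* `hN31e`  — `N31e_statement` (this seat's node, PROVED as `N31e_holds`);
* `hnorm`  — ⟪θ_φ(χ′), θ_φ(χ′)⟫ = ∫∫_{[U(W_i)]²} χ′(u) χ̄′(u′) K(u,u′) (definition of θ_φ(χ′) = ∫_{[U(W_i)]} θ_φ(·,u)χ′(u)du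
  and of K as the [G_U]-inner integral, tex l. 594–596; nodes N10/N31d);
* `hEuler` — N31f first sentence (pv07): ∫_{U(W_i)(𝔸)} ⟨ω(y)φ,φ⟩χ′(y)dy = ∏_v I_v(φ_v), a real number `P`.
Output: `re ⟪θ,θ⟫ = c · vol([U(W_i)]) · P` with `vol([U(W_i)]) = (μ 𝓕).toReal`. -/
theorem rallis_field_of_N31e {μ : Measure A} {𝓕 : Set A} {ω : A →* (S ≃ₗᵢ[ℂ] S)} {φ : S} {χ' : A → ℂ}
    {K : A → A → ℂ} {c P : ℝ} {θ : E}
    (hN31e : N31e_statement μ 𝓕 ω φ χ' K (c : ℂ))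
    (hnorm : ⟪θ, θ⟫_ℂ = ∫ u in 𝓕, ∫ u' in 𝓕, χ' u * conj (χ' u') * K u u' ∂μ ∂μ)
    (hEuler : ∫ y, inner ℂ φ (ω y φ) * χ' y ∂μ = (P : ℂ)) :
    RCLike.re ⟪θ, θ⟫_ℂ = c * (μ 𝓕).toReal * P := by
  unfold N31e_statement at hN31e
  rw [hnorm, hN31e, hEuler]
  have : (c : ℂ) * ((μ 𝓕).toReal : ℂ) * (P : ℂ) = ((c * (μ 𝓕).toReal * P : ℝ) : ℂ) := by push_cast; ring
  rw [this, RCLike.re_eq_complex_re, Complex.ofReal_re]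

/-- The same with the volume named: `vol = (μ 𝓕).toReal` (so pv13's `vol_pos` is `μ 𝓕 ≠ 0, ≠ ⊤`). -/
theorem rallis_field_of_N31e' {μ : Measure A} {𝓕 : Set A} {ω : A →* (S ≃ₗᵢ[ℂ] S)} {φ : S} {χ' : A → ℂ}
    {K : A → A → ℂ} {c P vol : ℝ} {θ : E} (hvol : vol = (μ 𝓕).toReal)
    (hN31e : N31e_statement μ 𝓕 ω φ χ' K (c : ℂ))
    (hnorm : ⟪θ, θ⟫_ℂ = ∫ u in 𝓕, ∫ u' in 𝓕, χ' u * conj (χ' u') * K u u' ∂μ ∂μ)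
    (hEuler : ∫ y, inner ℂ φ (ω y φ) * χ' y ∂μ = (P : ℂ)) :
    RCLike.re ⟪θ, θ⟫_ℂ = c * vol * P := by
  rw [hvol]; exact rallis_field_of_N31e hN31e hnorm hEuler

end HodgeCM.PerL34.RallisIP
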